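import Literature.MathematicalPhysics.QuantumLattice.FermionicTreeExpansionBounds
import Literature.Probability.LatticeModels.BattleFederbushTrees
import HarnessLib

/-!
# The `n!`-free bound as a sum over anchored trees

Topic `Literature/MathematicalPhysics/QuantumLattice`; continuation of
`FermionicTreeExpansionBounds.lean`.  There the truncated expectation was bounded by a sum over
*scripts* (ordered traversals of anchored cluster trees) of `assignBound (lines s) · ∫ w_s`.  Here
the scripts are regrouped by their anchored (cluster) tree `T = {ℓ₁, …, ℓ_k}`: the recursive Gram
bound depends on the lines only up to order (`assignBound_perm`), the lines determine the point set
(`Script.image_y_eq_of_lines_eq`), and the weights of the scripts with the same tree add up to one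
(`Script.sum_cubeIntegral_weight_eq_one`, Mastropietro 2008 Lemma 2.3); the anchored cluster trees
`lineSets v W` and their Cayley count are in `BattleFederbushTrees.lean`.  The result is the form in
which the bound is used in multiscale analysis (Benfatto–Giuliani–Mastropietro 2006, (2.66)/(2.77);
Mastropietro 2008, (2.118)–(2.121)):

`‖𝓔ᵀ(W)‖ ≤ Σ_{anchored cluster trees T on W} treeBound T`,

`treeBound T = Σ_{anchored field-line assignments along T} ∏_ℓ ‖G_ℓ‖ ∏_{rows left} ‖A‖ ∏_{columns left} ‖B‖`
(`norm_ursellOf_moment_le_sum_lineSets`).  Everything is proved; no named fact.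

## Sources

G. Benfatto, A. Giuliani, V. Mastropietro, Ann. Henri Poincaré 7 (2006), (2.66), (2.77)
(`BenfattoGiulianiMastropietro2006`); V. Mastropietro, *Non-Perturbative Renormalization* (2008),
§2.9, (2.118)–(2.121), Lemma 2.3 (`Mastropietro2008`).
-/

noncomputable section

open MvPolynomial Finsupp Matrix Finset Literature.RingTheory.MvPolynomial
open Literature.Probability.LatticeModels Literature.Probability.LatticeModels.BattleFederbush
open Literature.MeasureTheory.Integral Literature.Analysis.InnerProduct
open scoped InnerProductSpace

namespace Literature.MathematicalPhysics.QuantumLattice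

namespace FermionicTree

variable {𝕜 : Type*} [RCLike 𝕜] {E : Type*} [NormedAddCommGroup E] [InnerProductSpace 𝕜 E]
variable {ι : Type*} [DecidableEq ι] {F : Type*} [Fintype F] [LinearOrder F]
variable (c : F → ι) (A B : F → E)

/-! ### The recursive bound does not depend on the order of the lines -/

omit [Fintype F] in
/-- Two consecutive line extractions commute in the recursive bound. [folklore] -/
theorem assignBound_swap {r : ℕ} (e : Fin r → F) (ℓ₁ ℓ₂ : Sym2 ι) (L : List (Sym2 ι)) (I : Finset F)
    (jm : F → F) :
    assignBound 𝕜 c A B e (ℓ₁ :: ℓ₂ :: L) I jm = assignBound 𝕜 c A B e (ℓ₂ :: ℓ₁ :: L) I jm := by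
  -- the fully expanded double extraction
  have expand : ∀ m₁ m₂ : Sym2 ι, assignBound 𝕜 c A B e (m₁ :: m₂ :: L) I jm =
      ∑ p : Fin r × Fin r, ∑ q : Fin r × Fin r,
        if (e p.1 ∉ I ∧ s(c (e p.1), c (e p.2)) = m₁) ∧ (e q.1 ∉ insert (e p.1) I ∧ s(c (e q.1), c (e q.2)) = m₂) then
          ‖(⟪A (e p.1), B (e p.2)⟫_𝕜 : 𝕜)‖ * (‖(⟪A (e q.1), B (e q.2)⟫_𝕜 : 𝕜)‖ *
            assignBound 𝕜 c A B e L (insert (e q.1) (insert (e p.1) I))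
              (Function.update (Function.update jm (e p.1) (e p.2)) (e q.1) (e q.2)))
        else 0 := by
    intro m₁ m₂
    conv_lhs => simp only [assignBound, ← Fintype.sum_prod_type']
    refine sum_congr rfl fun p _ => ?_
    by_cases h1 : e p.1 ∉ I ∧ s(c (e p.1), c (e p.2)) = m₁
    · rw [if_pos h1, Finset.mul_sum]
      refine sum_congr rfl fun q _ => ?_
      by_cases h2 : e q.1 ∉ insert (e p.1) I ∧ s(c (e q.1), c (e q.2)) = m₂
      · rw [if_pos h2, if_pos ⟨h1, h2⟩]
      · rw [if_neg h2, if_neg (fun h => h2 h.2), mul_zero]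
    · rw [if_neg h1]
      exact (sum_eq_zero fun q _ => if_neg fun h => h1 h.1).symm
  rw [expand, expand, Finset.sum_comm]
  refine sum_congr rfl fun q _ => sum_congr rfl fun p _ => ?_
  -- the two conditions are equivalent and the data commute
  by_cases h : (e p.1 ∉ I ∧ s(c (e p.1), c (e p.2)) = ℓ₁) ∧ (e q.1 ∉ insert (e p.1) I ∧ s(c (e q.1), c (e q.2)) = ℓ₂)
  · have hne : e q.1 ≠ e p.1 := fun h' => h.2.1 (h' ▸ mem_insert_self _ _)
    have h' : (e q.1 ∉ I ∧ s(c (e q.1), c (e q.2)) = ℓ₂) ∧ (e p.1 ∉ insert (e q.1) I ∧ s(c (e p.1), c (e p.2)) = ℓ₁) :=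
      ⟨⟨fun hm => h.2.1 (mem_insert_of_mem hm), h.2.2⟩,
        ⟨fun hm => by rcases mem_insert.1 hm with hm | hm; exacts [hne hm.symm, h.1.1 hm], h.1.2⟩⟩
    rw [if_pos h, if_pos h', Finset.insert_comm, Function.update_comm hne]
    ring
  · rw [if_neg h, if_neg]
    rintro ⟨h1, h2⟩
    have hne : e p.1 ≠ e q.1 := fun h' => h2.1 (h' ▸ mem_insert_self _ _)
    exact h ⟨⟨fun hm => h2.1 (mem_insert_of_mem hm), h2.2⟩,
      ⟨fun hm => by rcases mem_insert.1 hm with hm | hm; exacts [hne hm.symm, h1.1 hm], h1.2⟩⟩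

omit [Fintype F] in
/-- **The recursive bound is invariant under permutations of the lines.** [folklore] -/
theorem assignBound_perm {r : ℕ} (e : Fin r → F) {L₁ L₂ : List (Sym2 ι)} (h : L₁.Perm L₂) :
    ∀ (I : Finset F) (jm : F → F), assignBound 𝕜 c A B e L₁ I jm = assignBound 𝕜 c A B e L₂ I jm := by
  induction h with
  | nil => intro I jm; rfl
  | cons ℓ _ ih =>
    intro I jm
    rw [assignBound, assignBound]
    refine sum_congr rfl fun i _ => sum_congr rfl fun j _ => ?_
    split_ifs
    · rw [ih _ _]
    · rfl
  | swap ℓ₁ ℓ₂ L => intro I jm; exact assignBound_swap c A B e ℓ₂ ℓ₁ L I jm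
  | trans _ _ ih₁ ih₂ => intro I jm; rw [ih₁ I jm, ih₂ I jm]

variable {v : ι} [Fintype ι]

/-- **The tree bound** of an anchored cluster tree `T` on `W`: the recursive Gram bound along any
listing of its lines (independent of the order, `assignBound_perm`) — the sum over the anchored
field-line assignments along `T` of `∏_ℓ ‖G_ℓ‖ ∏_{rows left} ‖A‖ ∏_{columns left} ‖B‖`
(Mastropietro 2008, (2.118) with Lemma 2.2). [folklore] -/
def treeBound (W : Finset ι) (T : Finset (Sym2 ι)) : ℝ :=
  assignBound 𝕜 c A B (enum c W) T.toList ∅ id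

omit [Fintype ι] in
/-- The tree bound is nonnegative. [folklore] -/
theorem treeBound_nonneg (W : Finset ι) (T : Finset (Sym2 ι)) : 0 ≤ treeBound (𝕜 := 𝕜) c A B W T :=
  assignBound_nonneg c A B _ _ _ _

omit [Fintype ι] in
/-- For a valid script the recursive bound along its lines is the tree bound of its line set.
[folklore] -/
theorem assignBound_lines_eq_treeBound {k : ℕ} (s : Script v k) (hs : s.Valid) (W : Finset ι) :
    assignBound 𝕜 c A B (enum c W) s.lines ∅ id = treeBound (𝕜 := 𝕜) c A B W s.lines.toFinset :=
  assignBound_perm c A B _ (List.perm_of_nodup_nodup_toFinset_eq (Script.nodup_lines s hs)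
    (Finset.nodup_toList _) (Finset.toList_toFinset _).symm) ∅ id

/-- **The `n!`-free bound on the truncated fermionic expectation, tree form**
(Benfatto–Giuliani–Mastropietro 2006, (2.66) with Gram–Hadamard, the structure behind (2.77);
Mastropietro 2008, (2.118)–(2.121) with Lemmas 2.2–2.3): for a propagator in Gram form
`G f f' = ⟪A f, B f'⟫`, the truncated expectation of the balanced monomials of the clusters in `W`
is bounded by the sum over the anchored cluster trees `T` on `W` (rooted at any `v ∈ W`) of the tree
bound — the sum over anchored field-line assignments along `T` of `∏_ℓ ‖G_ℓ‖` times the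
Gram–Hadamard product of the norms of the remaining fields; the interpolation weights have
disappeared because those of the scripts traversing the same tree add up to one. [cite: BenfattoGiulianiMastropietro2006, (2.66)] -/
theorem norm_ursellOf_moment_le_sum_lineSets (W : Finset ι) (hv : v ∈ W) :
    ‖ursellOf (moment c (gramProp 𝕜 A B)) W‖ ≤ ∑ T ∈ lineSets v W, treeBound (𝕜 := 𝕜) c A B W T := by
  refine (norm_ursellOf_moment_le c A B W hv).trans (le_of_eq ?_)
  -- insert the tree of each script
  have h1 : ∀ (k : ℕ) (hk : k ∈ range (Fintype.card ι)) (s : Script v k),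
      (if s.Valid ∧ univ.image s.y = W then
        assignBound 𝕜 c A B (enum c (univ.image s.y)) s.lines ∅ id * cubeIntegral ι ℝ (s.weight ℝ) else 0) =
      ∑ T ∈ lineSets v W, if s.Valid ∧ s.lines.toFinset = T then
        treeBound (𝕜 := 𝕜) c A B W T * cubeIntegral ι ℝ (s.weight ℝ) else 0 := by
    intro k hk s
    by_cases hs : s.Valid
    · simp only [hs, true_and]
      rw [Finset.sum_ite_eq]
      by_cases hW : univ.image s.y = W
      · have hmem : s.lines.toFinset ∈ lineSets v W :=
          mem_lineSets.2 ⟨k, mem_range.1 hk, s, hs, hW, rfl⟩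
        rw [if_pos hW, if_pos hmem, hW, assignBound_lines_eq_treeBound c A B s hs]
      · rw [if_neg hW, if_neg]
        intro hmem
        obtain ⟨k', -, s', hs', hW', hT⟩ := mem_lineSets.1 hmem
        exact hW ((Script.image_y_eq_of_lines_eq s s' hT.symm).trans hW')
    · simp only [hs, false_and, if_false]
      exact (sum_const_zero).symm
  rw [sum_congr rfl fun k hk => sum_congr rfl fun s _ => h1 k hk s]
  -- exchange the sums and use Lemma 2.3
  calc ∑ k ∈ range (Fintype.card ι), ∑ s : Script v k, ∑ T ∈ lineSets v W,
        (if s.Valid ∧ s.lines.toFinset = T then treeBound (𝕜 := 𝕜) c A B W T * cubeIntegral ι ℝ (s.weight ℝ) else 0)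
      = ∑ T ∈ lineSets v W, ∑ k ∈ range (Fintype.card ι), ∑ s : Script v k,
          (if s.Valid ∧ s.lines.toFinset = T then treeBound (𝕜 := 𝕜) c A B W T * cubeIntegral ι ℝ (s.weight ℝ) else 0) := by
        rw [Finset.sum_comm]; exact sum_congr rfl fun k _ => Finset.sum_comm
    _ = ∑ T ∈ lineSets v W, treeBound (𝕜 := 𝕜) c A B W T * ∑ k ∈ range (Fintype.card ι), ∑ s : Script v k,
          (if s.Valid ∧ s.lines.toFinset = T then cubeIntegral ι ℝ (s.weight ℝ) else 0) := by
        refine sum_congr rfl fun T _ => ?_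
        rw [Finset.mul_sum]
        refine sum_congr rfl fun k _ => ?_
        rw [Finset.mul_sum]
        refine sum_congr rfl fun s _ => ?_
        rw [mul_ite, mul_zero]
    _ = ∑ T ∈ lineSets v W, treeBound (𝕜 := 𝕜) c A B W T := by
        refine sum_congr rfl fun T hT => ?_
        obtain ⟨k₀, -, s₀, hs₀, -, rfl⟩ := mem_lineSets.1 hT
        rw [Script.sum_cubeIntegral_weight_eq_one s₀ hs₀, mul_one]

/-- **Cayley form of the `n!`-free bound**: with `M` a common bound for the tree bounds of the
anchored cluster trees on `W`, `‖𝓔ᵀ(W)‖ ≤ |W|^{|W|-2} · M` — the number of anchored cluster trees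
being at most the number of labelled trees on `W` (Mastropietro 2008, Lemma 2.4 with (2.118);
Benfatto–Giuliani–Mastropietro 2006, (2.66)). [cite: Mastropietro2008, Lemma 2.4 (2.121)] -/
theorem norm_ursellOf_moment_le_pow_mul (W : Finset ι) (hv : v ∈ W) {M : ℝ} (hM0 : 0 ≤ M)
    (hM : ∀ T ∈ lineSets v W, treeBound (𝕜 := 𝕜) c A B W T ≤ M) :
    ‖ursellOf (moment c (gramProp 𝕜 A B)) W‖ ≤ (W.card : ℝ) ^ (W.card - 2) * M := by
  refine (norm_ursellOf_moment_le_sum_lineSets c A B W hv).trans ?_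
  calc ∑ T ∈ lineSets v W, treeBound (𝕜 := 𝕜) c A B W T ≤ ∑ _T ∈ lineSets v W, M := sum_le_sum hM
    _ = (lineSets v W).card * M := by rw [sum_const, nsmul_eq_mul]
    _ ≤ (W.card : ℝ) ^ (W.card - 2) * M := by
        refine mul_le_mul_of_nonneg_right ?_ hM0
        exact_mod_cast card_lineSets_le_pow hv

end FermionicTree

end Literature.MathematicalPhysics.QuantumLattice
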